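import Summits.HodgeConjecture.HodgeConjecture.Theses.EightfoldBlochSeeds
import Summits.HodgeConjecture.HodgeConjecture.Theorems.Ring2AbelianAllWeilSimilarAnchors
import Literature.AlgebraicGeometry.HodgeTheory.WeilFamilyReach
import Literature.AlgebraicGeometry.HodgeTheory.WeilClassesRationalPlane
import Literature.AlgebraicGeometry.VanGeemen1994.WeilDiscriminantOfHyperbolic
import HarnessLib

/-!
# Route `EightfoldBlochSeeds`, crux `ReachHyperbolic` (item stmt-HodgeConjecture-18883, REFEREED NAMED FACT
# `weilFamilyReach_hyperbolic`), line `moduli-riemann` (`Cruxes/ReachHyperbolic/Lines/moduli_riemann.lean` 1ba65e5152037605):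
# the crux BY NAME from Deligne's reach BY SIMILITUDE (`weilFamilyReach_similar` = item stmt-HodgeConjecture-23605 `SimilarReach`)

HONEST FRAMING. Nothing here proves `ReachHyperbolic`, `SimilarReach`, any stub of the line (`stub_moduliComplete`,
`stub_riemannRealisable`, `stub_rung_riemannSurfaces` — fine PEL moduli, Riemann's existence theorem at Weil type, its surface case),
rung H2, HC_AV or the Hodge conjecture; neither reach fact is discharged (the tree constructs no moduli space of abelian varieties, no
universal family, no period map). UNCONDITIONAL door algebra: one implication between two NAMED FACTS, by tree theorems only; no
definition and no Literature fact is introduced (D-0026). Census-neutral.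

WHAT IS HERE (leafhand `leafhand-hodge-eightfoldblochseed-1-g0`). The line card of `moduli-riemann` records that the crux-level surface rung
lives on the SIBLING crux `SimilarReach` (stmt-23605, declared verbatim as `Literature.AlgebraicGeometry.HodgeTheory.weilFamilyReach_similar`
in `Theses.KleimanBFSeeds`, `Theses.DoublyPolarisedTransport`, `Theses.RealMultiplicationPencil`), «23605 ⟹ 18883 by
`weilFamilyReach_hyperbolic_of_similar`» — but that implication lives in the venture module
`Summits/Ventures/HSemireg/WeilFamilyReachHyperbolicOfSimilar.lean` (cell `pub-hsemireg`, typer seat p11), OUTSIDE the farm build and not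
importable from `Theorems/` (the skeleton re-proves its other venture bridge inline for the same reason). This file re-hosts it in citable
form, same proof (credited, not claimed), and states the by-name door:

* `weilFamilyReach_hyperbolic_of_weilFamilyReach_similar` — `weilFamilyReach_similar → weilFamilyReach_hyperbolic` (Deligne's own remark,
  LNM 900 Cor. 4.2: two split hermitian forms of rank `2n` are isometric): a hyperbolic anchor and a hyperbolic target are of Weil type
  (`isWeilType_of_isHyperbolicWeilType`), both `K`-symmetrised classes have the SPLIT discriminant class `[(-1)ⁿ]`
  (`VanGeemen1994.hasWeilDiscriminantNondeg_neg_one_pow_of_isHyperbolicWeilType`), members with Gram witnesses of the same class are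
  Weil-similar (ring 2's `isWeilSimilar_of_hasWeilDiscriminantNondeg`, Landherr on the carriers), and the Weil planes of Weil-type members are of
  type `(n, n)` and non-zero (`IsWeilType.isOfHodgeType_of_mem_weilClassesOf`, `exists_isRationalClass_ne_zero_mem_weilClassesOf`).
* `reachHyperbolic_of_weilFamilyReach_similar` — THE DOOR BY NAME: `weilFamilyReach_similar → Theses.EightfoldBlochSeeds.ReachHyperbolic`
  (so a proof of item 23605, whose statement IS `weilFamilyReach_similar`, closes item 18883 by `exact reachHyperbolic_of_weilFamilyReach_similar
  SimilarReach_holds`; the copy `Theses.EightfoldTwistedSheafSeeds.ReachHyperbolic` has the same body).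

Consequence for the route's trust base: `EightfoldBlochSeeds.closes` needs ONE reach fact (by similitude) instead of the hyperbolic one,
exactly as the venture's kernel does.

## References

[cite: Deligne1982HodgeCycles, §4 Cor. 4.2, Prop. 4.4 and proof of Thm. 4.8 (pp. 47–52)] [cite: vanGeemen1994HodgeAV, Lemma 5.2 (1)–(4), 5.3–5.4]
[cite: Landherr1936HermitianForms, Satz]
-/

noncomputable section

-- single-problem summit (Problem = Summit): the mandated namespace repeats `HodgeConjecture`.
set_option linter.dupNamespace false

open CategoryTheory AlgebraicGeometry
open Literature.AlgebraicGeometry Literature.AlgebraicGeometry.Motives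
open Literature.AlgebraicGeometry.HodgeTheory Literature.AlgebraicGeometry.VanGeemen1994
open Literature.AlgebraicTopology.SingularHomology

namespace Summit.HodgeConjecture.HodgeConjecture.Theorems

open Summit.HodgeConjecture.HodgeConjecture.Ring2.Hypotheses
open Summit.HodgeConjecture.HodgeConjecture.Ring2.AbelianAll

/-- **Deligne's reach by similitude implies the hyperbolic reach**: `weilFamilyReach_similar → weilFamilyReach_hyperbolic` (both NAMED FACTS,
REFEREED, undischarged; the implication is a tree theorem). Hyperbolic ⟹ Weil type (Deligne (b) ⟹ Prop. 4.4); hyperbolic ⟹ split discriminant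
class `[(-1)ⁿ]` (van Geemen Lemma 5.2 (2)–(3), (5.4.1)); same class ⟹ Weil-similar (Landherr, ring 2); Weil planes of Weil-type members are of
type `(n, n)` and non-zero. Re-hosted verbatim from the venture file `Summits/Ventures/HSemireg/WeilFamilyReachHyperbolicOfSimilar.lean` (not
importable from `Theorems/`); credited, not claimed. [cite: Deligne1982HodgeCycles, §4 Cor. 4.2, Prop. 4.4 and proof of Thm. 4.8 (pp. 47–52)]
[cite: vanGeemen1994HodgeAV, Lemma 5.2 (1)–(4), 5.3–5.4] [cite: Landherr1936HermitianForms, Satz] -/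
theorem weilFamilyReach_hyperbolic_of_weilFamilyReach_similar (hF : weilFamilyReach_similar) : weilFamilyReach_hyperbolic := by
  intro n d hn hd P ψ₀ e a hP hψ ha ha0 hhypP w hwW hw0 A φ eA aA hA hφ haA haA0 hhypA
  have hn' : 0 < n := hn
  have hd' : 0 < d := hd
  -- both members are of Weil type `(n, d)`
  have hWP : IsWeilType P ψ₀ n d := isWeilType_of_isHyperbolicWeilType hn' hd' hP hψ e ha ha0 hhypP
  have hWA : IsWeilType A φ n d := isWeilType_of_isHyperbolicWeilType hn' hd' hA hφ eA haA haA0 hhypA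
  -- the anchor's class is of type `(n, n)`; the target carries a non-zero `(n, n)` Weil class
  have hwH : IsOfHodgeType (2 * n) P.X (2 * n) n n w := hWP.isOfHodgeType_of_mem_weilClassesOf hwW
  obtain ⟨wA, hwAW, hwA0, -⟩ := exists_isRationalClass_ne_zero_mem_weilClassesOf hn' hA hd' hφ
  have hwAH : IsOfHodgeType (2 * n) A.X (2 * n) n n wA := hWA.isOfHodgeType_of_mem_weilClassesOf hwAW
  -- both symmetrised classes have the split discriminant class `[(-1)ⁿ]`, hence the members are Weil-similar (Landherr)
  have hδP := hasWeilDiscriminantNondeg_neg_one_pow_of_isHyperbolicWeilType hn' hP hd' hψ e ha ha0 hhypP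
  have hδA := hasWeilDiscriminantNondeg_neg_one_pow_of_isHyperbolicWeilType hn' hA hd' hφ eA haA haA0 hhypA
  have hsim := isWeilSimilar_of_hasWeilDiscriminantNondeg hWP hWA e ha ha0 eA haA haA0 hδP hδA
  -- Deligne's reach by similitude gives the family clause
  exact hF n d hn hd P ψ₀ e a hP hψ ha ha0 w hwW hw0 hwH A φ eA aA hA hφ haA haA0 ⟨wA, hwAW, hwA0, hwAH⟩ hsim

/-- **THE DOOR BY NAME: `ReachHyperbolic` (item stmt-HodgeConjecture-18883) from Deligne's reach by similitude** — the statement of the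
sibling item stmt-HodgeConjecture-23605 `SimilarReach` (`:= weilFamilyReach_similar` in `Theses.KleimanBFSeeds` / `.DoublyPolarisedTransport` /
`.RealMultiplicationPencil`): once 23605 holds, `exact reachHyperbolic_of_weilFamilyReach_similar ‹_›` closes 18883 by name.
[cite: Deligne1982HodgeCycles, §4 Cor. 4.2 and proof of Thm. 4.8 (pp. 47–52)] [cite: vanGeemen1994HodgeAV, Lemma 5.2, 5.3–5.4] -/
theorem reachHyperbolic_of_weilFamilyReach_similar (hF : weilFamilyReach_similar) :
    Summit.HodgeConjecture.HodgeConjecture.Theses.EightfoldBlochSeeds.ReachHyperbolic :=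
  weilFamilyReach_hyperbolic_of_weilFamilyReach_similar hF

end Summit.HodgeConjecture.HodgeConjecture.Theorems

end
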